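import Literature.Analysis.FluidPDE.OseenDuhamelJointContinuity
import Literature.Analysis.FluidPDE.NSBoundedMildOseenDuhamel
import HarnessLib

/-!
# The Oseen–Duhamel term near a point of LOCAL boundedness: the far/late error is paid by the
# energy, and `B_s(u,u)` is continuous up to the final time

Analysis/FluidPDE support file (everything proved; no definitions, no named facts).

The tree's joint-continuity theorem `continuousOn_uncurry_oseenDuhamel` (KNSS 2009, §3 (3.10) /
§4 p. 8: the Duhamel term `B^ν_s(u,v)(t)(x) = ∫_{(s,t)}∫ K(ν(t−τ), x−y)[u(τ,y), v(τ,y)] dy dτ` of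
fields BOUNDED on the slab `(s, T) × E` is jointly continuous on the CLOSED slab `[s, T] × E`) does
not apply to a field which is bounded on every earlier slab `(s, t) × E`, `t < T`, but not up to
`T` — the velocity of a solution blowing up at `T`. This file localises it. Two facts:

* `exists_enorm_oseenDuhamel_sub_le_of_eqOn` — **the far/late error is paid by the energy**:
  if two bounded measurable fields `v`, `w` on `(s, t) × E` AGREE at all times `τ ≤ t'` and, at
  the later times, on the ball `B(x₀, ρ)`, then at every point `x ∈ B(x₀, ρ/2)`
  `‖B^ν_s(v,v)(t)(x) − B^ν_s(w,w)(t)(x)‖ ≤ 2 C_K ((ρ/2)²)^{−(d+1)/2} (t − t') · 𝓔`, where `𝓔`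
  bounds the slice energies `∫|v(τ)|²`, `∫|w(τ)|²` on `(t', t)` and `C_K` is Koch–Tataru's kernel
  constant (`‖K(σ,z)[a,b]‖ ≤ C_K (σ + |z|²)^{−(d+1)/2}|a||b|`, (14)): outside the ball the kernel
  seen from `x` is bounded by `C_K ((ρ/2)²)^{−(d+1)/2}` uniformly in the kernel time, and the two
  tensors are each bounded by `|·|²`;
* `exists_continuousOn_oseenDuhamel_top` — **continuity up to the top near a point of local
  boundedness**: let `u` be a.e.-strongly measurable on `(s, T) × E`, bounded on `(s, t) × E` for
  every `t < T`, bounded on `(s, T) × B(x₀, ρ)`, with slice energies `∫|u(τ)|² ≤ 𝓔 < ∞`; then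
  there is `Ψ` continuous on the CLOSURE of `V = (s, T) × B(x₀, ρ/2)` with `Ψ = B^ν_s(u,u)` on `V`.
  Proof: the truncations `u_n = u · 1{τ ≤ t_n ∨ y ∈ B(x₀,ρ)}`, `t_n ↑ T`, are bounded on the whole
  slab, so `Ψ_n = B^ν_s(u_n,u_n)` is continuous on `[s, T] × E` by the tree theorem; by the first
  fact `‖B^ν_s(u,u) − Ψ_n‖ ≤ δ_n → 0` uniformly on `V`, hence (`le_on_closure`) `(Ψ_n)` is uniformly
  Cauchy on `closure V`, and its uniform limit `Ψ` is continuous there and equals `B^ν_s(u,u)` on `V`.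

These are the two analytic inputs of the E–C row «the blow-up profile of a Clay blow-up WITH force
is continuous off the singular slice» (`Summits/NavierStokesRegularity/FluidComputer/
ClayBlowupForcedProfile.lean`, cell `ns-blowup`, seat ecbridge-2 g11): near a backward-bounded point
the only unbounded inputs of the Duhamel term are far away, where the energy controls them.

## Mathlib / tree search

Tree (`lean search 'oseenDuhamel_eq_integral_prod|integrable_oseenKernel_duhamel_bounded|
continuousOn_uncurry_oseenDuhamel|exists_norm_oseenKernel_le'`): `oseenDuhamel_eq_integral_prod`,
`integrable_oseenKernel_duhamel_bounded`, `aestronglyMeasurable_oseenKernel_duhamel'`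
(`NSBoundedMildOseenDuhamel`), `continuousOn_uncurry_oseenDuhamel` (`OseenDuhamelJointContinuity`),
`exists_norm_oseenKernel_le` (`KochTataruKernel`), `volume_restrict_prod_univ_eq_prod`. Nothing in
the tree localises the Duhamel term in space (`lean search 'oseenDuhamel.*ball|local.*oseenDuhamel'`:
only the far/near split IN TIME, `OseenDuhamelSplit`). Mathlib: `enorm_integral_le_lintegral_enorm`,
`lintegral_prod_le`, `lintegral_add_left'`, `lintegral_const_mul'`, `le_on_closure`,
`cauchySeq_of_le_tendsto_0`, `TendstoUniformlyOn.continuousOn`, `Metric.tendstoUniformlyOn_iff`.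

## References

* G. Koch, N. Nadirashvili, G. Seregin, V. Šverák, *Liouville theorems for the Navier–Stokes
  equations and applications*, Acta Math. 203 (2009) 83–105 = arXiv:0709.3599, §3 (3.10), §4
  p. 8 (the bound for `B`). [KochNadirashviliSereginSverak2009]
* H. Koch, D. Tataru, *Well-posedness for the Navier–Stokes equations*, Adv. Math. 157 (2001)
  22–35, §3 (14) (the pointwise kernel bound). [KochTataruAdvMath2001]
* P. G. Lemarié-Rieusset, *The Navier–Stokes Problem in the 21st Century*, CRC Press 2016,
  Thm. 6.1 (6.12) (the Oseen integral equation). [LemarieRieusset2016]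
-/

noncomputable section

open MeasureTheory TopologicalSpace Set Function Filter Metric
open _root_.Topology
open scoped ENNReal NNReal RealInnerProductSpace

namespace Literature.Analysis.FluidPDE

variable {E : Type*} [NormedAddCommGroup E] [InnerProductSpace ℝ E] [FiniteDimensional ℝ E]
  [MeasurableSpace E] [BorelSpace E]

/-! ## §1 The far/late error of the Duhamel term is paid by the energy -/

/-- **The far/late error of the Duhamel term is paid by the energy** (mechanism: Koch–Tataru's
pointwise kernel bound (14), `‖K(σ,z)[a,b]‖ ≤ C_K (σ + |z|²)^{−(d+1)/2} |a| |b|`, which away from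
the diagonal is bounded uniformly in the kernel time; KNSS 2009, §4 p. 8, the estimate of `B`).
There is `C > 0` (Koch–Tataru's kernel constant) such that: for `ν > 0`, `s < t`, `s ≤ t' ≤ t`, two
fields `v`, `w` a.e.-strongly measurable and bounded by `M` on `(s, t) × E` which agree whenever
`τ ≤ t'` or `y ∈ B(x₀, ρ)` (`ρ > 0`), with slice energies `∫ |v(τ)|², ∫ |w(τ)|² ≤ 𝓔` for
`τ ∈ (t', t)`, and every `x ∈ B(x₀, ρ/2)`,
`‖B^ν_s(v,v)(t)(x) − B^ν_s(w,w)(t)(x)‖ ≤ 2 C ((ρ/2)²)^{−(d+1)/2} (t − t') · 𝓔`.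
[cite: KochTataruAdvMath2001, §3 (14)] [cite: KochNadirashviliSereginSverak2009, §4 p. 8 (the bound for B) (arXiv:0709.3599)] -/
theorem exists_enorm_oseenDuhamel_sub_le_of_eqOn :
    ∃ C : ℝ, 0 < C ∧ ∀ {ν : ℝ}, 0 < ν → ∀ {s t t' M ρ : ℝ} {v w : ℝ → E → E} {x₀ x : E} {Ev : ℝ≥0∞},
      s < t → s ≤ t' → t' ≤ t → 0 ≤ M →
      AEStronglyMeasurable (uncurry v) ((volume : Measure (ℝ × E)).restrict (Ioo s t ×ˢ univ)) →
      AEStronglyMeasurable (uncurry w) ((volume : Measure (ℝ × E)).restrict (Ioo s t ×ˢ univ)) →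
      (∀ τ ∈ Ioo s t, ∀ y, ‖v τ y‖ ≤ M) → (∀ τ ∈ Ioo s t, ∀ y, ‖w τ y‖ ≤ M) → 0 < ρ →
      (∀ τ ∈ Ioo s t, ∀ y, (τ ≤ t' ∨ y ∈ ball x₀ ρ) → w τ y = v τ y) →
      (∀ τ ∈ Ioo t' t, ∫⁻ y, ‖v τ y‖ₑ ^ 2 ≤ Ev) → (∀ τ ∈ Ioo t' t, ∫⁻ y, ‖w τ y‖ₑ ^ 2 ≤ Ev) →
      x ∈ ball x₀ (ρ / 2) →
      ‖oseenDuhamel ν s v v t x - oseenDuhamel ν s w w t x‖ₑ ≤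
        ENNReal.ofReal (2 * C * ((ρ / 2) ^ 2) ^ (-(((Module.finrank ℝ E : ℝ) + 1) / 2)) * (t - t')) *
          Ev := by
  obtain ⟨C, hC, hK⟩ := exists_norm_oseenKernel_le (E := E)
  refine ⟨C, hC, ?_⟩
  intro ν hν s t t' M ρ v w x₀ x Ev hst hst' ht't hM hvm hwm hvM hwM hρ hagree hEv hEw hx
  set d : ℝ := (Module.finrank ℝ E : ℝ) with hd
  -- the constant seen from `x` outside the ball
  set A : ℝ := C * ((ρ / 2) ^ 2) ^ (-((d + 1) / 2)) with hA
  have hρ2 : 0 < (ρ / 2) ^ 2 := by positivity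
  have hA0 : 0 ≤ A := mul_nonneg hC.le (Real.rpow_nonneg hρ2.le _)
  -- the two integrands on the product slab
  set μ : Measure (ℝ × E) := (volume : Measure (ℝ × E)).restrict (Ioo s t ×ˢ univ) with hμ
  set Fv : ℝ × E → E := fun p => oseenKernel (ν * (t - p.1)) (x - p.2) (v p.1 p.2) (v p.1 p.2)
    with hFv
  set Fw : ℝ × E → E := fun p => oseenKernel (ν * (t - p.1)) (x - p.2) (w p.1 p.2) (w p.1 p.2)
    with hFw
  have hIv : Integrable Fv μ := integrable_oseenKernel_duhamel_bounded hν hvm hvm hM hvM hvM hst le_rfl x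
  have hIw : Integrable Fw μ := integrable_oseenKernel_duhamel_bounded hν hwm hwm hM hwM hwM hst le_rfl x
  have hBv : oseenDuhamel ν s v v t x = ∫ p, Fv p ∂μ :=
    oseenDuhamel_eq_integral_prod hν hvm hvm hM hvM hvM hst le_rfl x
  have hBw : oseenDuhamel ν s w w t x = ∫ p, Fw p ∂μ :=
    oseenDuhamel_eq_integral_prod hν hwm hwm hM hwM hwM hst le_rfl x
  -- the dominating functions
  set c : ℝ → ℝ≥0∞ := (Ioi t').indicator fun _ => ENNReal.ofReal A with hc
  set G₁ : ℝ × E → ℝ≥0∞ := fun p => c p.1 * ‖v p.1 p.2‖ₑ ^ 2 with hG₁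
  set G₂ : ℝ × E → ℝ≥0∞ := fun p => c p.1 * ‖w p.1 p.2‖ₑ ^ 2 with hG₂
  -- ### the pointwise bound on the slab
  have hpt : ∀ p ∈ Ioo s t ×ˢ (univ : Set E), ‖Fv p - Fw p‖ₑ ≤ G₁ p + G₂ p := by
    rintro ⟨τ, y⟩ ⟨hτ, -⟩
    by_cases hgood : τ ≤ t' ∨ y ∈ ball x₀ ρ
    · -- the fields agree: no error
      have he : w τ y = v τ y := hagree τ hτ y hgood
      simp only [hFv, hFw, he, sub_self, enorm_zero, zero_le]
    · -- late and far: both tensors are bounded by the kernel constant seen from `x`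
      push Not at hgood
      obtain ⟨hτt', hy⟩ := hgood
      have hcτ : c τ = ENNReal.ofReal A := by
        simp only [hc, indicator_of_mem (mem_Ioi.2 hτt')]
      have hσ : 0 < ν * (t - τ) := mul_pos hν (sub_pos.2 hτ.2)
      -- `‖x - y‖ ≥ ρ/2`
      have hxy : ρ / 2 ≤ ‖x - y‖ := by
        have h1 : ρ ≤ dist y x₀ := le_of_not_gt fun h => hy (mem_ball.2 h)
        have h2 : dist x x₀ < ρ / 2 := mem_ball.1 hx
        have h3 : dist y x₀ ≤ dist y x + dist x x₀ := dist_triangle y x x₀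
        rw [← dist_eq_norm, dist_comm]
        linarith
      have hker : C * (ν * (t - τ) + ‖x - y‖ ^ 2) ^ (-((d + 1) / 2)) ≤ A := by
        rw [hA]
        refine mul_le_mul_of_nonneg_left ?_ hC.le
        refine Real.rpow_le_rpow_of_nonpos hρ2 ?_ (by linarith [show (0 : ℝ) ≤ d from by positivity])
        have : (ρ / 2) ^ 2 ≤ ‖x - y‖ ^ 2 := pow_le_pow_left₀ (by positivity) hxy 2
        linarith [hσ.le]
      have hbv : ‖Fv (τ, y)‖ ≤ A * ‖v τ y‖ ^ 2 := by
        calc ‖Fv (τ, y)‖ ≤ C * (ν * (t - τ) + ‖x - y‖ ^ 2) ^ (-((d + 1) / 2)) * ‖v τ y‖ * ‖v τ y‖ :=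
              hK hσ (x - y) (v τ y) (v τ y)
          _ ≤ A * ‖v τ y‖ * ‖v τ y‖ := by gcongr
          _ = A * ‖v τ y‖ ^ 2 := by ring
      have hbw : ‖Fw (τ, y)‖ ≤ A * ‖w τ y‖ ^ 2 := by
        calc ‖Fw (τ, y)‖ ≤ C * (ν * (t - τ) + ‖x - y‖ ^ 2) ^ (-((d + 1) / 2)) * ‖w τ y‖ * ‖w τ y‖ :=
              hK hσ (x - y) (w τ y) (w τ y)
          _ ≤ A * ‖w τ y‖ * ‖w τ y‖ := by gcongr
          _ = A * ‖w τ y‖ ^ 2 := by ring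
      have hreal : ‖Fv (τ, y) - Fw (τ, y)‖ ≤ A * ‖v τ y‖ ^ 2 + A * ‖w τ y‖ ^ 2 :=
        (norm_sub_le _ _).trans (add_le_add hbv hbw)
      -- to `ℝ≥0∞`
      have e1 : ENNReal.ofReal (A * ‖v τ y‖ ^ 2) = ENNReal.ofReal A * ‖v τ y‖ₑ ^ 2 := by
        rw [ENNReal.ofReal_mul hA0, ENNReal.ofReal_pow (norm_nonneg _), ofReal_norm]
      have e2 : ENNReal.ofReal (A * ‖w τ y‖ ^ 2) = ENNReal.ofReal A * ‖w τ y‖ₑ ^ 2 := by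
        rw [ENNReal.ofReal_mul hA0, ENNReal.ofReal_pow (norm_nonneg _), ofReal_norm]
      calc ‖Fv (τ, y) - Fw (τ, y)‖ₑ = ENNReal.ofReal ‖Fv (τ, y) - Fw (τ, y)‖ :=
            (ofReal_norm _).symm
        _ ≤ ENNReal.ofReal (A * ‖v τ y‖ ^ 2 + A * ‖w τ y‖ ^ 2) := ENNReal.ofReal_le_ofReal hreal
        _ = ENNReal.ofReal A * ‖v τ y‖ₑ ^ 2 + ENNReal.ofReal A * ‖w τ y‖ₑ ^ 2 := by
            rw [ENNReal.ofReal_add (by positivity) (by positivity), e1, e2]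
        _ = G₁ (τ, y) + G₂ (τ, y) := by simp only [hG₁, hG₂, hcτ]
  have hpt_ae : ∀ᵐ p ∂μ, ‖Fv p - Fw p‖ₑ ≤ G₁ p + G₂ p := by
    rw [hμ, ae_restrict_iff' (measurableSet_Ioo.prod MeasurableSet.univ)]
    exact ae_of_all _ hpt
  -- ### the integrals of the dominating functions
  have hc_meas : Measurable c := measurable_const.indicator measurableSet_Ioi
  have hcτ_le : ∀ τ, c τ ≤ ENNReal.ofReal A := fun τ => by
    by_cases h : τ ∈ Ioi t'
    · simp only [hc, indicator_of_mem h, le_refl]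
    · simp only [hc, indicator_of_notMem h, zero_le]
  have hint_c : ∫⁻ τ in Ioo s t, c τ * Ev = ENNReal.ofReal A * Ev * ENNReal.ofReal (t - t') := by
    have h1 : (fun τ => c τ * Ev) = (Ioi t').indicator (fun _ => ENNReal.ofReal A * Ev) := by
      funext τ
      by_cases h : τ ∈ Ioi t'
      · simp only [hc, indicator_of_mem h]
      · simp only [hc, indicator_of_notMem h, zero_mul]
    rw [h1, lintegral_indicator measurableSet_Ioi, Measure.restrict_restrict measurableSet_Ioi,
      setLIntegral_const]
    have h2 : Ioi t' ∩ Ioo s t = Ioo t' t := by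
      ext τ
      simp only [mem_inter_iff, mem_Ioi, mem_Ioo]
      constructor
      · rintro ⟨h1, -, h3⟩; exact ⟨h1, h3⟩
      · rintro ⟨h1, h3⟩; exact ⟨h1, lt_of_le_of_lt hst' h1, h3⟩
    rw [h2, Real.volume_Ioo]
  have hG₁int : ∫⁻ p, G₁ p ∂μ ≤ ENNReal.ofReal A * Ev * ENNReal.ofReal (t - t') := by
    rw [hμ, volume_restrict_prod_univ_eq_prod]
    refine (lintegral_prod_le _).trans ?_
    rw [← hint_c]
    refine setLIntegral_mono' measurableSet_Ioo fun τ hτ => ?_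
    show ∫⁻ y, c τ * ‖v τ y‖ₑ ^ 2 ≤ c τ * Ev
    rw [lintegral_const_mul' _ _ ((hcτ_le τ).trans_lt ENNReal.ofReal_lt_top).ne]
    by_cases h : τ ∈ Ioi t'
    · exact mul_le_mul' le_rfl (hEv τ ⟨h, hτ.2⟩)
    · simp only [hc, indicator_of_notMem h, zero_mul, le_refl]
  have hG₂int : ∫⁻ p, G₂ p ∂μ ≤ ENNReal.ofReal A * Ev * ENNReal.ofReal (t - t') := by
    rw [hμ, volume_restrict_prod_univ_eq_prod]
    refine (lintegral_prod_le _).trans ?_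
    rw [← hint_c]
    refine setLIntegral_mono' measurableSet_Ioo fun τ hτ => ?_
    show ∫⁻ y, c τ * ‖w τ y‖ₑ ^ 2 ≤ c τ * Ev
    rw [lintegral_const_mul' _ _ ((hcτ_le τ).trans_lt ENNReal.ofReal_lt_top).ne]
    by_cases h : τ ∈ Ioi t'
    · exact mul_le_mul' le_rfl (hEw τ ⟨h, hτ.2⟩)
    · simp only [hc, indicator_of_notMem h, zero_mul, le_refl]
  have hG₁m : AEMeasurable G₁ μ := by
    have h1 : AEMeasurable (fun p : ℝ × E => c p.1) μ := (hc_meas.comp measurable_fst).aemeasurable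
    exact h1.mul (hvm.enorm.pow_const 2)
  -- ### assembly
  have htt' : 0 ≤ t - t' := sub_nonneg.2 ht't
  calc ‖oseenDuhamel ν s v v t x - oseenDuhamel ν s w w t x‖ₑ
      = ‖∫ p, (Fv p - Fw p) ∂μ‖ₑ := by rw [hBv, hBw, integral_sub hIv hIw]
    _ ≤ ∫⁻ p, ‖Fv p - Fw p‖ₑ ∂μ := enorm_integral_le_lintegral_enorm _
    _ ≤ ∫⁻ p, G₁ p + G₂ p ∂μ := lintegral_mono_ae hpt_ae
    _ = ∫⁻ p, G₁ p ∂μ + ∫⁻ p, G₂ p ∂μ := lintegral_add_left' hG₁m _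
    _ ≤ ENNReal.ofReal A * Ev * ENNReal.ofReal (t - t') +
          ENNReal.ofReal A * Ev * ENNReal.ofReal (t - t') := add_le_add hG₁int hG₂int
    _ = ENNReal.ofReal (2 * C * ((ρ / 2) ^ 2) ^ (-((d + 1) / 2)) * (t - t')) * Ev := by
        rw [← two_mul, show 2 * C * ((ρ / 2) ^ 2) ^ (-((d + 1) / 2)) * (t - t') =
          2 * (A * (t - t')) by rw [hA]; ring, ENNReal.ofReal_mul (by norm_num : (0:ℝ) ≤ 2),
          ENNReal.ofReal_mul hA0, ENNReal.ofReal_ofNat]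
        ring

/-! ## §2 Continuity of `B_s(u,u)` up to the top near a point of local boundedness -/

/-- **The Duhamel term of a field bounded on every earlier slab and near `x₀` up to the top, with
bounded slice energies, is continuous up to the final time near `x₀`** (mechanism: KNSS 2009,
§3 (3.10) / §4 p. 8 for the truncations `u · 1{τ ≤ t_n ∨ y ∈ B(x₀,ρ)}`, which are bounded on the
whole slab, and the energy-paid far/late error `exists_enorm_oseenDuhamel_sub_le_of_eqOn`, uniform
on `(s, T) × B(x₀, ρ/2)`; a uniform limit of functions continuous on the closed slab is continuous).
For `ν > 0`, `s < T`, `u` a.e.-strongly measurable on `(s, T) × E`, bounded on `(s, t) × E` for each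
`t < T`, bounded on `(s, T) × B(x₀, ρ)` (`ρ > 0`), with `∫ |u(τ)|² ≤ 𝓔 < ∞` for `τ ∈ (s, T)`: there is
`Ψ` continuous on `closure ((s, T) × B(x₀, ρ/2))` with `Ψ(t, x) = B^ν_s(u,u)(t)(x)` on
`(s, T) × B(x₀, ρ/2)`.
[cite: KochNadirashviliSereginSverak2009, §3 (3.10) and §4 p. 8 (the bound for B) (arXiv:0709.3599)] [cite: KochTataruAdvMath2001, §3 (14)] -/
theorem exists_continuousOn_oseenDuhamel_top {ν : ℝ} (hν : 0 < ν) {s T : ℝ} (hsT : s < T)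
    {u : ℝ → E → E}
    (hum : AEStronglyMeasurable (uncurry u) ((volume : Measure (ℝ × E)).restrict (Ioo s T ×ˢ univ)))
    (hbd : ∀ t < T, ∃ N : ℝ, ∀ τ ∈ Ioo s t, ∀ y, ‖u τ y‖ ≤ N)
    {x₀ : E} {ρ B : ℝ} (hρ : 0 < ρ) (hB : ∀ τ ∈ Ioo s T, ∀ y ∈ ball x₀ ρ, ‖u τ y‖ ≤ B)
    {Eu : ℝ≥0∞} (hEu : Eu ≠ ⊤) (hE : ∀ τ ∈ Ioo s T, ∫⁻ y, ‖u τ y‖ₑ ^ 2 ≤ Eu) :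
    ∃ Ψ : ℝ × E → E, ContinuousOn Ψ (closure (Ioo s T ×ˢ ball x₀ (ρ / 2))) ∧
      ∀ p ∈ Ioo s T ×ˢ ball x₀ (ρ / 2), Ψ p = oseenDuhamel ν s u u p.1 p.2 := by
  classical
  haveI : CompleteSpace E := FiniteDimensional.complete ℝ E
  obtain ⟨C, hC, hfar⟩ := exists_enorm_oseenDuhamel_sub_le_of_eqOn (E := E)
  set d : ℝ := (Module.finrank ℝ E : ℝ) with hd
  set A : ℝ := 2 * C * ((ρ / 2) ^ 2) ^ (-((d + 1) / 2)) with hA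
  have hA0 : 0 ≤ A := by
    have : 0 ≤ ((ρ / 2) ^ 2) ^ (-((d + 1) / 2)) := Real.rpow_nonneg (by positivity) _
    rw [hA]; positivity
  set V : Set (ℝ × E) := Ioo s T ×ˢ ball x₀ (ρ / 2) with hV
  set Bu : ℝ × E → E := fun p => oseenDuhamel ν s u u p.1 p.2 with hBu
  -- ### the truncation times `t_n ↑ T`
  set η : ℕ → ℝ := fun n => (T - s) / ((n : ℝ) + 2) with hη
  set tn : ℕ → ℝ := fun n => T - η n with htn
  have hTs : 0 < T - s := sub_pos.2 hsT
  have hη0 : ∀ n, 0 < η n := fun n => by rw [hη]; positivity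
  have hηlt : ∀ n, η n < T - s := fun n => by
    rw [hη, div_lt_iff₀ (by positivity)]
    nlinarith [n.cast_nonneg (α := ℝ)]
  have hη_anti : ∀ {n m : ℕ}, n ≤ m → η m ≤ η n := fun {n m} hnm => by
    rw [hη]
    exact div_le_div_of_nonneg_left hTs.le (by positivity) (by exact_mod_cast Nat.add_le_add_right hnm 2)
  have hηlim : Tendsto η atTop (𝓝 0) := by
    rw [hη]
    exact tendsto_const_nhds.div_atTop
      (tendsto_atTop_add_const_right _ _ tendsto_natCast_atTop_atTop)
  have htn_s : ∀ n, s < tn n := fun n => by simp only [htn]; linarith [hηlt n]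
  have htn_T : ∀ n, tn n < T := fun n => by simp only [htn]; linarith [hη0 n]
  -- ### the truncated fields `u_n = u · 1{τ ≤ t_n ∨ y ∈ B(x₀,ρ)}`
  set S : ℕ → Set (ℝ × E) := fun n => Iic (tn n) ×ˢ (univ : Set E) ∪ (univ : Set ℝ) ×ˢ ball x₀ ρ
    with hS
  have hSmeas : ∀ n, MeasurableSet (S n) := fun n =>
    (measurableSet_Iic.prod MeasurableSet.univ).union (MeasurableSet.univ.prod measurableSet_ball)
  have hmemS : ∀ n (τ : ℝ) (y : E), (τ, y) ∈ S n ↔ τ ≤ tn n ∨ y ∈ ball x₀ ρ := fun n τ y => by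
    simp only [hS, mem_union, mem_prod, mem_Iic, mem_univ, and_true, true_and]
  set un : ℕ → ℝ → E → E := fun n τ y => (S n).indicator (uncurry u) (τ, y) with hun
  have hun_of_mem : ∀ n τ y, (τ ≤ tn n ∨ y ∈ ball x₀ ρ) → un n τ y = u τ y := fun n τ y h => by
    simp only [hun, indicator_of_mem ((hmemS n τ y).2 h), uncurry_apply_pair]
  have hun_of_not_mem : ∀ n τ y, ¬ (τ ≤ tn n ∨ y ∈ ball x₀ ρ) → un n τ y = 0 := fun n τ y h => by
    simp only [hun, indicator_of_notMem (fun h' => h ((hmemS n τ y).1 h'))]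
  have hun_norm_le : ∀ n τ y, ‖un n τ y‖ ≤ ‖u τ y‖ := fun n τ y => by
    simp only [hun]
    exact (norm_indicator_le_norm_self _ _).trans (le_of_eq rfl)
  have hunm_T : ∀ n, AEStronglyMeasurable (uncurry (un n))
      ((volume : Measure (ℝ × E)).restrict (Ioo s T ×ˢ univ)) := fun n => by
    have h := hum.indicator (hSmeas n)
    exact h.congr (Eventually.of_forall fun p => rfl)
  -- bounds of the truncations on the whole slab
  have hmid : ∀ n, (tn n + T) / 2 < T := fun n => by linarith [htn_T n]
  choose N hN using fun n => hbd ((tn n + T) / 2) (hmid n)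
  set M : ℕ → ℝ := fun n => max (max (N n) B) 0 with hM
  have hM0 : ∀ n, 0 ≤ M n := fun n => le_max_right _ _
  have hunM : ∀ n, ∀ τ ∈ Ioo s T, ∀ y, ‖un n τ y‖ ≤ M n := by
    intro n τ hτ y
    by_cases h : τ ≤ tn n ∨ y ∈ ball x₀ ρ
    · rw [hun_of_mem n τ y h]
      rcases h with h | h
      · have hτ' : τ ∈ Ioo s ((tn n + T) / 2) := ⟨hτ.1, by linarith [htn_T n]⟩
        exact (hN n τ hτ' y).trans ((le_max_left _ _).trans (le_max_left _ _))
      · exact (hB τ hτ y h).trans ((le_max_right _ _).trans (le_max_left _ _))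
    · rw [hun_of_not_mem n τ y h, norm_zero]
      exact hM0 n
  -- ### the continuous approximants `Ψ_n = B_s(u_n, u_n)`
  set Ψn : ℕ → ℝ × E → E := fun n => uncurry (oseenDuhamel ν s (un n) (un n)) with hΨn
  have hΨn_cont : ∀ n, ContinuousOn (Ψn n) (Icc s T ×ˢ univ) := fun n =>
    continuousOn_uncurry_oseenDuhamel hν (hM0 n) (hunm_T n) (hunm_T n) (hunM n) (hunM n)
  -- ### the uniform error on `V`
  set δ : ℕ → ℝ := fun n => A * η n * Eu.toReal with hδ
  have hδ0 : ∀ n, 0 ≤ δ n := fun n => by rw [hδ]; exact mul_nonneg (mul_nonneg hA0 (hη0 n).le) ENNReal.toReal_nonneg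
  have hδ_anti : ∀ {n m : ℕ}, n ≤ m → δ m ≤ δ n := fun {n m} hnm => by
    rw [hδ]
    exact mul_le_mul_of_nonneg_right (mul_le_mul_of_nonneg_left (hη_anti hnm) hA0) ENNReal.toReal_nonneg
  have hδlim : Tendsto δ atTop (𝓝 0) := by
    have h := (hηlim.const_mul A).mul_const Eu.toReal
    rw [mul_zero, zero_mul] at h
    exact h
  have herr : ∀ n, ∀ p ∈ V, ‖Bu p - Ψn n p‖ ≤ δ n := by
    rintro n ⟨t, x⟩ ⟨ht, hx⟩
    -- the data of the far/late lemma on `(s, t)`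
    obtain ⟨Nt, hNt⟩ := hbd t ht.2
    set M' : ℝ := max (max Nt (M n)) 0 with hM'
    have hM'0 : 0 ≤ M' := le_max_right _ _
    have hsub : Ioo s t ×ˢ (univ : Set E) ⊆ Ioo s T ×ˢ univ :=
      prod_mono (Ioo_subset_Ioo_right ht.2.le) subset_rfl
    have hum_t : AEStronglyMeasurable (uncurry u)
        ((volume : Measure (ℝ × E)).restrict (Ioo s t ×ˢ univ)) :=
      hum.mono_measure (Measure.restrict_mono hsub le_rfl)
    have hunm_t : AEStronglyMeasurable (uncurry (un n))
        ((volume : Measure (ℝ × E)).restrict (Ioo s t ×ˢ univ)) :=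
      (hunm_T n).mono_measure (Measure.restrict_mono hsub le_rfl)
    have huM' : ∀ τ ∈ Ioo s t, ∀ y, ‖u τ y‖ ≤ M' := fun τ hτ y =>
      (hNt τ hτ y).trans ((le_max_left _ _).trans (le_max_left _ _))
    have hunM' : ∀ τ ∈ Ioo s t, ∀ y, ‖un n τ y‖ ≤ M' := fun τ hτ y =>
      (hunM n τ ⟨hτ.1, hτ.2.trans ht.2⟩ y).trans ((le_max_right _ _).trans (le_max_left _ _))
    set t' : ℝ := min (tn n) t with ht'
    have hst' : s ≤ t' := le_min (htn_s n).le ht.1.le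
    have ht't : t' ≤ t := min_le_right _ _
    have hagree : ∀ τ ∈ Ioo s t, ∀ y, (τ ≤ t' ∨ y ∈ ball x₀ ρ) → un n τ y = u τ y := by
      intro τ _ y h
      refine hun_of_mem n τ y ?_
      rcases h with h | h
      · exact Or.inl (h.trans (min_le_left _ _))
      · exact Or.inr h
    have hEv : ∀ τ ∈ Ioo t' t, ∫⁻ y, ‖u τ y‖ₑ ^ 2 ≤ Eu := fun τ hτ =>
      hE τ ⟨lt_of_le_of_lt hst' hτ.1, hτ.2.trans ht.2⟩
    have hEw : ∀ τ ∈ Ioo t' t, ∫⁻ y, ‖un n τ y‖ₑ ^ 2 ≤ Eu := by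
      intro τ hτ
      refine (lintegral_mono fun y => ?_).trans (hEv τ hτ)
      have h1 : ‖un n τ y‖ₑ ≤ ‖u τ y‖ₑ := by
        rw [← ofReal_norm, ← ofReal_norm]
        exact ENNReal.ofReal_le_ofReal (hun_norm_le n τ y)
      exact pow_le_pow_left' h1 2
    have hkey := hfar hν ht.1 hst' ht't hM'0 hum_t hunm_t huM' hunM' hρ hagree hEv hEw hx
    -- `t - t' ≤ η n`
    have hlag : t - t' ≤ η n := by
      rcases le_total (tn n) t with h | h
      · rw [ht', min_eq_left h]; simp only [htn]; linarith [ht.2]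
      · rw [ht', min_eq_right h]; linarith [(hη0 n).le]
    have hfin : ENNReal.ofReal (A * η n) * Eu ≠ ⊤ := ENNReal.mul_ne_top ENNReal.ofReal_ne_top hEu
    have hkey' : ‖oseenDuhamel ν s u u t x - oseenDuhamel ν s (un n) (un n) t x‖ₑ ≤
        ENNReal.ofReal (A * η n) * Eu := by
      refine hkey.trans (mul_le_mul' (ENNReal.ofReal_le_ofReal ?_) le_rfl)
      rw [hA]
      exact mul_le_mul_of_nonneg_left hlag hA0
    have h1 := ENNReal.toReal_mono hfin hkey'
    rw [toReal_enorm, ENNReal.toReal_mul, ENNReal.toReal_ofReal (mul_nonneg hA0 (hη0 n).le)] at h1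
    simpa only [hBu, hΨn, uncurry_apply_pair, hδ] using h1
  -- ### the approximants are uniformly Cauchy on `closure V`
  have hVc : closure V ⊆ Icc s T ×ˢ (univ : Set E) := by
    refine (closure_mono (Set.prod_mono Ioo_subset_Icc_self (subset_univ _))).trans ?_
    rw [(isClosed_Icc.prod isClosed_univ).closure_eq]
  have hcauchy : ∀ n m, ∀ p ∈ closure V, ‖Ψn n p - Ψn m p‖ ≤ δ n + δ m := by
    intro n m p hp
    refine le_on_closure (f := fun q => ‖Ψn n q - Ψn m q‖) (g := fun _ => δ n + δ m)
      (fun q hq => ?_) ?_ continuousOn_const hp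
    · calc ‖Ψn n q - Ψn m q‖ = ‖(Ψn n q - Bu q) + (Bu q - Ψn m q)‖ := by rw [sub_add_sub_cancel]
        _ ≤ ‖Ψn n q - Bu q‖ + ‖Bu q - Ψn m q‖ := norm_add_le _ _
        _ ≤ δ n + δ m := add_le_add (by rw [norm_sub_rev]; exact herr n q hq) (herr m q hq)
    · exact (((hΨn_cont n).mono hVc).sub ((hΨn_cont m).mono hVc)).norm
  -- ### the uniform limit
  have hlim : ∀ p ∈ closure V, ∃ a, Tendsto (fun n => Ψn n p) atTop (𝓝 a) := by
    intro p hp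
    refine cauchySeq_tendsto_of_complete (cauchySeq_of_le_tendsto_0 (fun k => δ k + δ k)
      (fun n m k hkn hkm => ?_) ?_)
    · rw [dist_eq_norm]
      exact (hcauchy n m p hp).trans (add_le_add (hδ_anti hkn) (hδ_anti hkm))
    · simpa using hδlim.add hδlim
  set Ψ : ℝ × E → E := fun p => limUnder atTop (fun n => Ψn n p) with hΨ
  have hΨlim : ∀ p ∈ closure V, Tendsto (fun n => Ψn n p) atTop (𝓝 (Ψ p)) := fun p hp =>
    tendsto_nhds_limUnder (hlim p hp)
  have hΨerr : ∀ n, ∀ p ∈ closure V, dist (Ψ p) (Ψn n p) ≤ δ n := by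
    intro n p hp
    have h1 : Tendsto (fun m => dist (Ψn n p) (Ψn m p)) atTop (𝓝 (dist (Ψn n p) (Ψ p))) :=
      tendsto_const_nhds.dist (hΨlim p hp)
    have h2 : Tendsto (fun m => δ n + δ m) atTop (𝓝 (δ n)) := by
      simpa using tendsto_const_nhds.add hδlim
    have h3 := le_of_tendsto_of_tendsto' h1 h2 fun m => by
      rw [dist_eq_norm]; exact hcauchy n m p hp
    rwa [dist_comm] at h3
  have hunif : TendstoUniformlyOn Ψn Ψ atTop (closure V) := by
    rw [Metric.tendstoUniformlyOn_iff]
    intro ε hε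
    filter_upwards [(tendsto_order.1 hδlim).2 ε hε] with n hn p hp
    exact (hΨerr n p hp).trans_lt hn
  refine ⟨Ψ, hunif.continuousOn (Eventually.of_forall fun n => (hΨn_cont n).mono hVc).frequently, ?_⟩
  -- ### `Ψ = B_s(u,u)` on `V`
  intro p hp
  have hpc : p ∈ closure V := subset_closure hp
  have h1 : Tendsto (fun n => Ψn n p) atTop (𝓝 (Bu p)) := by
    rw [tendsto_iff_dist_tendsto_zero]
    refine squeeze_zero (fun n => dist_nonneg) (fun n => ?_) hδlim
    rw [dist_comm, dist_eq_norm]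
    exact herr n p hp
  exact tendsto_nhds_unique (hΨlim p hpc) h1

end Literature.Analysis.FluidPDE

end
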